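import Literature.AlgebraicGeometry.ShimuraVarieties.UnitaryShimuraComplexGaloisDatum
import Literature.FieldTheory.AlgClosed.AutComplexGeneratedBySubfields
import HarnessLib

/-!
# The complex Galois datum of the unitary Shimura tower, II: multiplicativity of the reciprocity data and the
# assembly over the subgroup generated by the `Aut(ℂ/Eᵢ)` ([Deligne 1971] Prop. 5.10, complex half)

Topic `AlgebraicGeometry/ShimuraVarieties`; namespace `Literature.AlgebraicGeometry.ShimuraVarieties.UnitaryCanonicalModel`
(sequel of `UnitaryShimuraComplexGaloisDatum`).  THEOREMS ONLY (no definition, no instance, no named fact, no `sorry`).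
Cell `hodgecm-mathlib` (D-0151), row I-6 `descentToIntersection_printed`, half (Λ) «complex semilinear datum», assembly step.
Net Literature debt 0.

* §5 `IsArtinCorrespondent.mul ∕ .inv`, `recipFactor_mul ∕ _one`, `IsDiagTwist.mul ∕ .one ∕ .inv_of_recipFactor ∕ .one_recipFactor` —
  the reciprocity data `(s, r_{x₀}(s), d)` of [Milne2005ShimuraVarieties] Def. 12.8 (62) multiply and invert, so that the composite
  and inverse Galois twist automorphisms of `UnitaryShimuraComplexGaloisDatum` §4 are again twist automorphisms with legal data;
* §6 `ComplexRecordSystem.exists_galoisTwistAut_of_mem_closure` — for a family of forms `(Mᵢ, eᵢ)` of the complex tower over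
  number fields `Eᵢ ⊂ ℂ` containing `τ(L)` with reciprocity over `Eᵢ`, EVERY `σ` in the subgroup of `Aut(ℂ)` generated by the
  `Aut(ℂ/Eᵢ)` has, at every level, a Galois twist automorphism whose point action is (62) for every Artin correspondent of `σ`
  (closure induction: generators by §3, `1` ∕ products ∕ inverses by §4–§5).  With the generation theorem
  `Aut(ℂ/⋂Eᵢ) = ⟨⋃ Aut(ℂ/Eᵢ)⟩` (tree: `Complex.ringEquiv_induction_of_eq_iInf`, `Complex.fixingSubgroup_iInf_eq_iSup`) this is
  (`exists_galoisTwistAut_of_forall_mem_iInf`)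
  the semilinear `Aut(ℂ/⋂Eᵢ)`-datum on the complex tower that [Deligne1971TravauxShimura] Lemme 5.10.1 descends.

HC_CM is proved only modulo the 7 printed citations until rung 0 closes; this file discharges none of them by itself.

## References
* [Deligne1971TravauxShimura] P. Deligne, *Travaux de Shimura*, Sém. Bourbaki 389 (1971): Prop. 5.10 and Lemme 5.10.1 (pp. 157–158).
* [Milne2005ShimuraVarieties] J. S. Milne, *Introduction to Shimura varieties* (2005/2017): Def. 12.5 p. 113, Def. 12.8 (59)–(62) pp. 107–114, Thm. 13.6 p. 118.
-/

set_option autoImplicit false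

noncomputable section

open Function MulAction Topology NumberField IsDedekindDomain CategoryTheory CategoryTheory.Limits Matrix
  AlgebraicGeometry Cardinal
open scoped Matrix ComplexOrder
open Literature.AlgebraicGeometry.Motives
open Literature.NumberTheory.Automorphic Literature.NumberTheory.Automorphic.UnitaryGroup
open Literature.NumberTheory.Automorphic.Liu2021.AppendixC (C5.OpenCompactSubgroup C5.SmallLevel)
open Literature.Geometry.ComplexHyperbolic Literature.Geometry.ComplexHyperbolic.BallModel
open Literature.NumberTheory.Automorphic.ShimuraDissection

namespace Literature.AlgebraicGeometry.ShimuraVarieties.UnitaryCanonicalModel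

variable {L : Type} [Field L] [NumberField L] [IsCMField L] {H : Matrix (Fin 3) (Fin 3) L}
  {τ : L →+* ℂ} {T : GL (Fin 3) ℂ} {hT : formCongr (starRingEnd ℂ) T (H.map τ) = BallModel.J}
  {K₀ : C5.OpenCompactSubgroup ↥(finAdelic (↥(maximalRealSubfield L)) L (IsCMField.complexConj L) 3 H)}

/-! ### §5. Multiplicativity of the reciprocity data: Artin correspondents, reciprocity factors, diagonal twists -/

omit [IsCMField L] in
/-- **Artin correspondents multiply**: if `s ↔ σ` and `t ↔ ρ` under `art_L` (`IsArtinCorrespondent`, read through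
`L`-embeddings `L̄ → ℂ`), then `s·t ↔ σ·ρ`.  Two `L`-embeddings differ by an element of `Gal(L̄/L)`, conjugation by which does
not change classes in `Gal(L̄/L)^{ab}`; the Artin map is a homomorphism. [cite: Milne2005ShimuraVarieties, (59) p. 107 and p. 107 L9–15] -/
theorem IsArtinCorrespondent.mul (τ : L →+* ℂ) {s t : (FiniteAdeleRing (𝓞 L) L)ˣ} {σ ρ : ℂ ≃+* ℂ}
    (hs : IsArtinCorrespondent L τ s σ) (ht : IsArtinCorrespondent L τ t ρ) :
    IsArtinCorrespondent L τ (s * t) (σ * ρ) := by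
  letI : Algebra L ℂ := τ.toAlgebra
  obtain ⟨e, γ, he, hγ⟩ := hs
  obtain ⟨e', γ', he', hγ'⟩ := ht
  -- `ℂ` as an `L̄`-algebra through `e`; `δ := e'|` as an automorphism of `L̄` with `e ∘ δ = e'`
  letI : Algebra (AlgebraicClosure L) ℂ := e.toRingHom.toAlgebra
  haveI : IsScalarTower L (AlgebraicClosure L) ℂ :=
    IsScalarTower.of_algebraMap_eq fun x => (e.commutes x).symm
  let δ : AlgebraicClosure L ≃ₐ[L] AlgebraicClosure L := e'.restrictNormal' (AlgebraicClosure L)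
  have hδ : ∀ x, e (δ x) = e' x := fun x => by
    have h := AlgHom.restrictNormal_commutes e' (AlgebraicClosure L) x
    exact h
  let κ : Field.absoluteGaloisGroup L := (Field.absoluteGaloisGroup.toAlgEquiv L).symm δ
  have hκ : Field.absoluteGaloisGroup.toAlgEquiv L κ = δ := MulEquiv.apply_symm_apply _ _
  -- the conjugate `κ γ' κ⁻¹` of `γ'` is a restriction of `ρ` along `e`
  refine ⟨e, γ * (κ * γ' * κ⁻¹), fun x => ?_, ?_⟩
  · rw [map_mul, map_mul, map_mul, map_inv, hκ, RingAut.mul_apply, AlgEquiv.mul_apply, AlgEquiv.mul_apply,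
      AlgEquiv.mul_apply, he, AlgEquiv.aut_inv, hδ, he', ← hδ, AlgEquiv.apply_symm_apply]
  · have hfc : finiteIdeleClass L (s * t) = finiteIdeleClass L s * finiteIdeleClass L t := by
      unfold finiteIdeleClass
      rw [map_mul]
      rfl
    rw [map_mul, map_mul, map_mul, map_inv, mul_inv_cancel_comm, hfc, map_mul, mul_inv, hγ, hγ']

/-- **`r(s·t) = r(s)·r(t)`** for the reciprocity factor `r(s) = c(s)·s⁻¹`. [cite: Milne2005ShimuraVarieties, (60)–(61) p. 114] -/
theorem recipFactor_mul (s t : (FiniteAdeleRing (𝓞 L) L)ˣ) :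
    recipFactor L (s * t) = recipFactor L s * recipFactor L t := by
  simp only [recipFactor, Units.val_mul, _root_.mul_inv_rev, map_mul]
  ring

/-- **Diagonal twists multiply**: if `d` twists `v₃` by `t` and `d′` by `t′` (both fixing `v₃^⊥` pointwise), then `d·d′` twists
`v₃` by `t·t′`. [cite: Milne2005ShimuraVarieties, Def. 12.5 p. 113] -/
theorem IsDiagTwist.mul {v₃ : Fin 3 → L} {t t' : FiniteAdeleRing (𝓞 L) L}
    {d d' : finAdelic (↥(maximalRealSubfield L)) L (IsCMField.complexConj L) 3 H}
    (hd : IsDiagTwist L H v₃ t d) (hd' : IsDiagTwist L H v₃ t' d') :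
    IsDiagTwist L H v₃ (t * t') (d * d') := by
  obtain ⟨hd1, hd2⟩ := hd
  obtain ⟨hd1', hd2'⟩ := hd'
  have hprod : ((((d * d' : finAdelic (↥(maximalRealSubfield L)) L (IsCMField.complexConj L) 3 H) :
      finAdelic (↥(maximalRealSubfield L)) L (IsCMField.complexConj L) 3 H) :
      GL (Fin 3) (FiniteAdeleRing (𝓞 L) L)) : Matrix (Fin 3) (Fin 3) (FiniteAdeleRing (𝓞 L) L)) =
      (((d : finAdelic (↥(maximalRealSubfield L)) L (IsCMField.complexConj L) 3 H) :
        GL (Fin 3) (FiniteAdeleRing (𝓞 L) L)) : Matrix (Fin 3) (Fin 3) (FiniteAdeleRing (𝓞 L) L)) *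
      (((d' : finAdelic (↥(maximalRealSubfield L)) L (IsCMField.complexConj L) 3 H) :
        GL (Fin 3) (FiniteAdeleRing (𝓞 L) L)) : Matrix (Fin 3) (Fin 3) (FiniteAdeleRing (𝓞 L) L)) := by
    rw [Subgroup.coe_mul, Units.val_mul]
  refine ⟨?_, fun w hw => ?_⟩
  · rw [hprod, ← mulVec_mulVec, hd1', mulVec_smul, hd1, smul_smul, mul_comm]
  · rw [hprod, ← mulVec_mulVec, hd2' w hw, hd2 w hw]

/-- **The trivial twist**: `1` twists `v₃` by `1`. [cite: Milne2005ShimuraVarieties, Def. 12.5 p. 113] -/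
theorem IsDiagTwist.one (v₃ : Fin 3 → L) :
    IsDiagTwist L H v₃ 1 (1 : finAdelic (↥(maximalRealSubfield L)) L (IsCMField.complexConj L) 3 H) := by
  refine ⟨?_, fun w _ => ?_⟩
  · rw [OneMemClass.coe_one, Units.val_one, one_mulVec, one_smul]
  · rw [OneMemClass.coe_one, Units.val_one, one_mulVec]

/-- `r(1) = 1`. [cite: Milne2005ShimuraVarieties, (60)–(61) p. 114] -/
theorem recipFactor_one : recipFactor L 1 = 1 := by
  simp only [recipFactor, Units.val_one, inv_one, map_one, mul_one]

omit [IsCMField L] in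
/-- **Artin correspondents invert**: if `s ↔ σ` under `art_L` then `s⁻¹ ↔ σ⁻¹` (same `L`-embedding, inverse restriction;
`art_L` and `θ_L` are homomorphisms). [cite: Milne2005ShimuraVarieties, (59) p. 107] -/
theorem IsArtinCorrespondent.inv [IsCMField L] (τ : L →+* ℂ) {s : (FiniteAdeleRing (𝓞 L) L)ˣ} {σ : ℂ ≃+* ℂ}
    (hs : IsArtinCorrespondent L τ s σ) : IsArtinCorrespondent L τ s⁻¹ σ⁻¹ := by
  letI : Algebra L ℂ := τ.toAlgebra
  obtain ⟨e, γ, he, hγ⟩ := hs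
  refine ⟨e, γ⁻¹, fun x => ?_, ?_⟩
  · rw [map_inv, AlgEquiv.aut_inv]
    have h := he ((Field.absoluteGaloisGroup.toAlgEquiv L γ).symm x)
    rw [AlgEquiv.apply_symm_apply] at h
    rw [h]
    exact (σ.symm_apply_apply _).symm
  · have hcls : finiteIdeleClass L s⁻¹ = (finiteIdeleClass L s)⁻¹ := by
      unfold finiteIdeleClass
      rw [map_inv]
      rfl
    rw [map_inv, hγ, hcls, map_inv]

/-- **The inverse twist**: if `d` twists `v₃` by `r(s)` then `d⁻¹` twists `v₃` by `r(s⁻¹)` (`r(s)·r(s⁻¹) = r(1) = 1`).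
[cite: Milne2005ShimuraVarieties, Def. 12.5 p. 113; (60)–(61) p. 114] -/
theorem IsDiagTwist.inv_of_recipFactor {v₃ : Fin 3 → L} {s : (FiniteAdeleRing (𝓞 L) L)ˣ}
    {d : finAdelic (↥(maximalRealSubfield L)) L (IsCMField.complexConj L) 3 H}
    (hd : IsDiagTwist L H v₃ (recipFactor L s) d) : IsDiagTwist L H v₃ (recipFactor L s⁻¹) d⁻¹ := by
  have ht : recipFactor L s * recipFactor L s⁻¹ = 1 := by rw [← recipFactor_mul, mul_inv_cancel, recipFactor_one]
  have h := (IsDiagTwist.one (H := H) v₃).mul_inv H hd ht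
  simpa only [one_mul] using h

/-- `1` twists `v₃` by `r(1)`. [cite: Milne2005ShimuraVarieties, Def. 12.5 p. 113] -/
theorem IsDiagTwist.one_recipFactor (v₃ : Fin 3 → L) :
    IsDiagTwist L H v₃ (recipFactor L 1) (1 : finAdelic (↥(maximalRealSubfield L)) L (IsCMField.complexConj L) 3 H) := by
  rw [recipFactor_one]
  exact IsDiagTwist.one v₃

/-! ### §6. Assembly: a Galois twist automorphism for every element of the subgroup generated by the `Aut(ℂ/Eᵢ)` -/

namespace ComplexRecordSystem


/-- **The `e`-conjugate of `gal` IS the Galois twist — explicit form requested by the lead of the algebraic half** (A-p08,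
2026-08-28T06:29:54Z): for an `E`-form `(M, e)` of `Sc` along `ιE` with reciprocity over `E`, a ring automorphism `σ` of `ℂ` fixing
`ιE(E)` pointwise (regarded in `Aut_E(ℂ)` as `AlgEquiv.ofRingEquiv`) and an Artin correspondent `s` of `σ`, the NAMED morphism
`(e.app K).inv.left ≫ GaloisDescent.gal ℂ (M_K) σ ≫ (e.app K).hom.left` covers `Spec σ⁻¹`, and at EVERY diagonal special pair
`(v₃, x₀)` and twist `d` by `r_{x₀}(s)` its point action is Shimura reciprocity (62) (`galoisTwistAut_transport` of
`UnitaryShimuraComplexGaloisDatum`, binders rearranged; convention: `Spec σ ≫ P ≫ λ = P′`, `Spec σ` on the LEFT of the point).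
[cite: Deligne1979ShimuraVarieties, 2.2.4–2.2.5] [cite: Milne2005ShimuraVarieties, Def. 12.8 (62) p. 114; §13 p. 118 L21–26] -/
theorem galoisTwistAut_gal_transport (Sc : ComplexRecordSystem L H τ T hT K₀)
    {E : Type} [Field E] (ιE : E →+* ℂ) (M : C5.SmallLevel K₀ ⥤ SchemeOver E)
    (e : (M ⋙ Motives.baseChangeHom ιE) ≅ Sc.Mc) (hM : IsCanonicalDescentOver Sc ιE M e)
    (K : C5.SmallLevel K₀) (σ : ℂ ≃+* ℂ) (hσ : ∀ x : E, σ (ιE x) = ιE x)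
    {s : (FiniteAdeleRing (𝓞 L) L)ˣ} (hs : IsArtinCorrespondent L τ s σ) :
    letI : Algebra E ℂ := ιE.toAlgebra
    ((((e.app K).inv.left : (Sc.Mc.obj K).left ⟶ GaloisDescent.bc ℂ (M.obj K)) ≫
          GaloisDescent.gal ℂ (M.obj K) (AlgEquiv.ofRingEquiv (f := σ) hσ) ≫
            ((e.app K).hom.left : GaloisDescent.bc ℂ (M.obj K) ⟶ (Sc.Mc.obj K).left)) ≫ (Sc.Mc.obj K).hom =
        (Sc.Mc.obj K).hom ≫ Spec.map (CommRingCat.ofHom (σ.symm : ℂ →+* ℂ))) ∧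
      ∀ (v₃ : Fin 3 → L) (x₀ : Ball), IsLinePoint L τ T v₃ x₀ →
        ∀ d : finAdelic (↥(maximalRealSubfield L)) L (IsCMField.complexConj L) 3 H, IsDiagTwist L H v₃ (recipFactor L s) d →
          ∀ a : finAdelic (↥(maximalRealSubfield L)) L (IsCMField.complexConj L) 3 H,
            Spec.map (CommRingCat.ofHom (σ : ℂ →+* ℂ)) ≫
                ((Sc.pts K).symm (ShimuraSet.mk L H τ T hT K.1.1 x₀ a)).toSpecHom ≫
                  (((e.app K).inv.left : (Sc.Mc.obj K).left ⟶ GaloisDescent.bc ℂ (M.obj K)) ≫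
                    GaloisDescent.gal ℂ (M.obj K) (AlgEquiv.ofRingEquiv (f := σ) hσ) ≫
                      ((e.app K).hom.left : GaloisDescent.bc ℂ (M.obj K) ⟶ (Sc.Mc.obj K).left)) =
              ((Sc.pts K).symm (ShimuraSet.mk L H τ T hT K.1.1 x₀ (d * a))).toSpecHom := by
  letI : Algebra E ℂ := ιE.toAlgebra
  have hH : ∀ i j, cmConjRingHom L (H i j) = H j i := cmConjRingHom_apply_eq_of_formCongr_eq_J L H τ T hT
  refine ⟨?_, fun v₃ x₀ hx₀ d hd a => ?_⟩
  · -- (sl) does not see the special pair; feed `galoisTwistAut_transport` the CM point of any negative `L`-line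
    obtain ⟨v₃, hv₃⟩ := exists_mem_negCone_embedding (H := H) hT
    obtain ⟨x₀, hx₀⟩ := (exists_unique_isLinePoint L H τ T hT v₃ hv₃).exists
    obtain ⟨d, hd⟩ := exists_isDiagTwist_recipFactor (H := H) (v₃ := v₃) hH (hermForm_self_ne_zero_of_mem_negCone hv₃) s
    exact (galoisTwistAut_transport Sc ιE M e hM K (AlgEquiv.ofRingEquiv (f := σ) hσ) hs hx₀ hd).1
  · exact (galoisTwistAut_transport Sc ιE M e hM K (AlgEquiv.ofRingEquiv (f := σ) hσ) hs hx₀ hd).2 a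

set_option maxHeartbeats 800000 in -- large adelic / Shimura-set terms: instance-heavy statements
/-- **The complex Galois datum of a family of forms** ([Deligne1971TravauxShimura] Prop. 5.10, first half of the proof, run on
the complex tower): let `(Mᵢ, eᵢ)` be forms of `Sc` over number fields `Eᵢ ⊂ ℂ` containing `τ(L)`, with Shimura reciprocity (62)
over `Eᵢ` (`IsCanonicalDescentOver`).  Then EVERY `σ` in the subgroup of `Aut(ℂ)` generated by the `Aut(ℂ/Eᵢ)` (for a finite family
this is `Aut(ℂ/⋂Eᵢ)`, by the Galois correspondence — the crew's half P2) fixes `τ(L)` and has, at every level `K`, a Galois twist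
automorphism `λ_K(σ)`: an automorphism of `(Sc.Mc_K).left` covering `Spec σ⁻¹` whose point action is (62) for EVERY Artin
correspondent `s` of `σ` and twist `d` by `r_{x₀}(s)` — generators by §3, identity ∕ products ∕ inverses by §4–§5, the passage between
correspondents by `galoisTwistAut_pt_of_pt`.  By §2 these `λ_K(σ)` are unique and natural in `K`; this is the semilinear
`Aut(ℂ/⋂Eᵢ)`-datum on the complex tower that [Deligne1971TravauxShimura] Lemme 5.10.1 descends.
[cite: Deligne1971TravauxShimura, Prop. 5.10 and Lemme 5.10.1 (pp. 157–158)] [cite: Milne2005ShimuraVarieties, Thm. 13.6 p. 118; Def. 12.8 (62) p. 114] -/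
theorem exists_galoisTwistAut_of_mem_closure (Sc : ComplexRecordSystem L H τ T hT K₀) {ι : Type}
    (Ei : ι → IntermediateField ℚ ℂ) (hτ : ∀ (i : ι) (x : L), τ x ∈ Ei i)
    (hMi : ∀ i : ι, ∃ (M : C5.SmallLevel K₀ ⥤ SchemeOver ↥(Ei i)) (e : (M ⋙ Motives.baseChange ↥(Ei i) ℂ) ≅ Sc.Mc),
      IsCanonicalDescentOver Sc (algebraMap ↥(Ei i) ℂ) M e)
    {v₃ : Fin 3 → L} {x₀ : Ball} (hx₀ : IsLinePoint L τ T v₃ x₀)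
    (σ : ℂ ≃+* ℂ) (hσ : σ ∈ Subgroup.closure (⋃ i : ι, {ρ : ℂ ≃+* ℂ | ∀ x : ↥(Ei i), ρ x = x}))
    (K : C5.SmallLevel K₀) :
    ∃ lam : (Sc.Mc.obj K).left ≅ (Sc.Mc.obj K).left,
      lam.hom ≫ (Sc.Mc.obj K).hom = (Sc.Mc.obj K).hom ≫ Spec.map (CommRingCat.ofHom (σ.symm : ℂ →+* ℂ)) ∧
      ∀ s : (FiniteAdeleRing (𝓞 L) L)ˣ, IsArtinCorrespondent L τ s σ →
        ∀ d : finAdelic (↥(maximalRealSubfield L)) L (IsCMField.complexConj L) 3 H, IsDiagTwist L H v₃ (recipFactor L s) d →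
          ∀ a : finAdelic (↥(maximalRealSubfield L)) L (IsCMField.complexConj L) 3 H,
            Spec.map (CommRingCat.ofHom (σ : ℂ →+* ℂ)) ≫
                ((Sc.pts K).symm (ShimuraSet.mk L H τ T hT K.1.1 x₀ a)).toSpecHom ≫ lam.hom =
              ((Sc.pts K).symm (ShimuraSet.mk L H τ T hT K.1.1 x₀ (d * a))).toSpecHom := by
  have hH : ∀ i j, cmConjRingHom L (H i j) = H j i := cmConjRingHom_apply_eq_of_formCongr_eq_J L H τ T hT
  have hv : hermForm (cmConjRingHom L) H v₃ v₃ ≠ 0 := hermForm_self_ne_zero_of_isLinePoint L H τ T hT hx₀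
  revert K
  -- induction over the generated subgroup, carrying «`σ` fixes `τ(L)`» along
  suffices h : (∀ x : L, σ (τ x) = τ x) ∧ ∀ K : C5.SmallLevel K₀, ∃ lam : (Sc.Mc.obj K).left ≅ (Sc.Mc.obj K).left,
      lam.hom ≫ (Sc.Mc.obj K).hom = (Sc.Mc.obj K).hom ≫ Spec.map (CommRingCat.ofHom (σ.symm : ℂ →+* ℂ)) ∧
      ∀ s : (FiniteAdeleRing (𝓞 L) L)ˣ, IsArtinCorrespondent L τ s σ →
        ∀ d : finAdelic (↥(maximalRealSubfield L)) L (IsCMField.complexConj L) 3 H, IsDiagTwist L H v₃ (recipFactor L s) d →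
          ∀ a : finAdelic (↥(maximalRealSubfield L)) L (IsCMField.complexConj L) 3 H,
            Spec.map (CommRingCat.ofHom (σ : ℂ →+* ℂ)) ≫
                ((Sc.pts K).symm (ShimuraSet.mk L H τ T hT K.1.1 x₀ a)).toSpecHom ≫ lam.hom =
              ((Sc.pts K).symm (ShimuraSet.mk L H τ T hT K.1.1 x₀ (d * a))).toSpecHom from h.2
  induction hσ using Subgroup.closure_induction with
  | mem ρ hρ =>
    obtain ⟨i, hi⟩ := Set.mem_iUnion.mp hρ
    have hfix : ∀ x : L, ρ (τ x) = τ x := fun x => hi ⟨τ x, hτ i x⟩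
    refine ⟨hfix, fun K => ?_⟩
    obtain ⟨M, e, hM⟩ := hMi i
    obtain ⟨s, hs⟩ := exists_finiteIdele_isArtinCorrespondent L τ ρ hfix
    obtain ⟨d, hd⟩ := exists_isDiagTwist_recipFactor (H := H) (v₃ := v₃) hH hv s
    obtain ⟨lam, hsl, hpt⟩ := exists_galoisTwistAut_of_isCanonicalDescentOver Sc (algebraMap ↥(Ei i) ℂ) M e hM K ρ
      (fun x => hi x) hs hx₀ hd
    exact ⟨lam, hsl, fun s' hs' d' hd' a => galoisTwistAut_pt_of_pt Sc K ρ hx₀ hs hs' hd hd' hpt a⟩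
  | one =>
    refine ⟨fun x => rfl, fun K => ⟨Iso.refl _, (galoisTwistAut_one Sc K x₀).1, fun s' hs' d' hd' a => ?_⟩⟩
    exact galoisTwistAut_pt_of_pt Sc K 1 hx₀ (isArtinCorrespondent_one_one L τ) hs' (IsDiagTwist.one_recipFactor v₃) hd'
      (galoisTwistAut_one Sc K x₀).2 a
  | mul ρ ρ' _ _ ih ih' =>
    obtain ⟨hfix, hP⟩ := ih
    obtain ⟨hfix', hP'⟩ := ih'
    refine ⟨fun x => ?_, fun K => ?_⟩
    · rw [RingAut.mul_apply, hfix' x, hfix x]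
    obtain ⟨lam, hsl, hpt⟩ := hP K
    obtain ⟨lam', hsl', hpt'⟩ := hP' K
    obtain ⟨s, hs⟩ := exists_finiteIdele_isArtinCorrespondent L τ ρ hfix
    obtain ⟨d, hd⟩ := exists_isDiagTwist_recipFactor (H := H) (v₃ := v₃) hH hv s
    obtain ⟨s', hs'⟩ := exists_finiteIdele_isArtinCorrespondent L τ ρ' hfix'
    obtain ⟨d', hd'⟩ := exists_isDiagTwist_recipFactor (H := H) (v₃ := v₃) hH hv s'
    obtain ⟨hsl2, hpt2⟩ := galoisTwistAut_mul Sc K ρ ρ' x₀ lam lam' hsl (hpt s hs d hd) hsl' (hpt' s' hs' d' hd')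
    refine ⟨lam' ≪≫ lam, hsl2, fun s'' hs'' d'' hd'' a => ?_⟩
    have hdd : IsDiagTwist L H v₃ (recipFactor L (s * s')) (d * d') := by
      rw [recipFactor_mul]
      exact hd.mul hd'
    exact galoisTwistAut_pt_of_pt Sc K (ρ * ρ') hx₀ (hs.mul τ hs') hs'' hdd hd'' hpt2 a
  | inv ρ _ ih =>
    obtain ⟨hfix, hP⟩ := ih
    have hfix' : ∀ x : L, ρ⁻¹ (τ x) = τ x := fun x => by
      have h := congrArg ρ.symm (hfix x)
      rw [RingEquiv.symm_apply_apply] at h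
      exact h.symm
    refine ⟨hfix', fun K => ?_⟩
    obtain ⟨lam, hsl, hpt⟩ := hP K
    obtain ⟨s, hs⟩ := exists_finiteIdele_isArtinCorrespondent L τ ρ hfix
    obtain ⟨d, hd⟩ := exists_isDiagTwist_recipFactor (H := H) (v₃ := v₃) hH hv s
    obtain ⟨hsl2, hpt2⟩ := galoisTwistAut_symm Sc K ρ x₀ lam hsl (hpt s hs d hd)
    exact ⟨lam.symm, hsl2, fun s' hs' d' hd' a =>
      galoisTwistAut_pt_of_pt Sc K ρ⁻¹ hx₀ (hs.inv τ) hs' (hd.inv_of_recipFactor) hd' hpt2 a⟩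

/-- **The complex Galois datum over the intersection** — `exists_galoisTwistAut_of_mem_closure` combined with the GENERATION theorem
`Aut(ℂ/⋂ᵢEᵢ) = ⟨⋃ᵢ Aut(ℂ/Eᵢ)⟩` for a finite nonempty family of number fields in `ℂ` (the tree's
`Complex.ringEquiv_induction_of_eq_iInf` ∕ `Complex.induction_on_fixingSubgroup_iInf`,
[Deligne1971TravauxShimura] Prop. 5.10 proof: «`Gal(F/E)` est engendré par les `Gal(F/Eᵢ)`»): for forms `(Mᵢ, eᵢ)` of `Sc` over the
`Eᵢ ∋ τ(L)` with reciprocity over `Eᵢ`, EVERY ring automorphism `σ` of `ℂ` fixing `⋂ᵢ Eᵢ` pointwise has, at every level, a Galois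
twist automorphism with point action (62) for every Artin correspondent of `σ`.  This is the input of the algebraic half (descent of
the level schemes along `ℂ ∕ ⋂Eᵢ`, [Deligne1971TravauxShimura] Lemme 5.10.1). [cite: Deligne1971TravauxShimura, Prop. 5.10 and Lemme 5.10.1 (pp. 157–158)]
[cite: Milne2005ShimuraVarieties, Def. 12.8 (62) p. 114] -/
theorem exists_galoisTwistAut_of_forall_mem_iInf (Sc : ComplexRecordSystem L H τ T hT K₀) {ι : Type} [Finite ι] [Nonempty ι]
    (Ei : ι → IntermediateField ℚ ℂ) [∀ i, FiniteDimensional ℚ ↥(Ei i)] (hτ : ∀ (i : ι) (x : L), τ x ∈ Ei i)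
    (hMi : ∀ i : ι, ∃ (M : C5.SmallLevel K₀ ⥤ SchemeOver ↥(Ei i)) (e : (M ⋙ Motives.baseChange ↥(Ei i) ℂ) ≅ Sc.Mc),
      IsCanonicalDescentOver Sc (algebraMap ↥(Ei i) ℂ) M e)
    {v₃ : Fin 3 → L} {x₀ : Ball} (hx₀ : IsLinePoint L τ T v₃ x₀)
    (σ : ℂ ≃+* ℂ) (hσ : ∀ x : ↥(⨅ i, Ei i), σ x = x) (K : C5.SmallLevel K₀) :
    ∃ lam : (Sc.Mc.obj K).left ≅ (Sc.Mc.obj K).left,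
      lam.hom ≫ (Sc.Mc.obj K).hom = (Sc.Mc.obj K).hom ≫ Spec.map (CommRingCat.ofHom (σ.symm : ℂ →+* ℂ)) ∧
      ∀ s : (FiniteAdeleRing (𝓞 L) L)ˣ, IsArtinCorrespondent L τ s σ →
        ∀ d : finAdelic (↥(maximalRealSubfield L)) L (IsCMField.complexConj L) 3 H, IsDiagTwist L H v₃ (recipFactor L s) d →
          ∀ a : finAdelic (↥(maximalRealSubfield L)) L (IsCMField.complexConj L) 3 H,
            Spec.map (CommRingCat.ofHom (σ : ℂ →+* ℂ)) ≫
                ((Sc.pts K).symm (ShimuraSet.mk L H τ T hT K.1.1 x₀ a)).toSpecHom ≫ lam.hom =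
              ((Sc.pts K).symm (ShimuraSet.mk L H τ T hT K.1.1 x₀ (d * a))).toSpecHom := by
  -- generation of `Aut(ℂ/⋂Eᵢ)` by the `Aut(ℂ/Eᵢ)` (tree, plain-automorphism word form) ⇒ membership in the closure
  have hmem : σ ∈ Subgroup.closure (⋃ i : ι, {ρ : ℂ ≃+* ℂ | ∀ x : ↥(Ei i), ρ x = x}) :=
    Literature.FieldTheory.AlgClosed.Complex.ringEquiv_induction_of_eq_iInf Ei (⨅ i, Ei i) rfl
      (p := fun ρ : ℂ ≃+* ℂ => ρ ∈ Subgroup.closure (⋃ i : ι, {ρ : ℂ ≃+* ℂ | ∀ x : ↥(Ei i), ρ x = x}))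
      (fun i ρ hρ => Subgroup.subset_closure (Set.mem_iUnion.mpr ⟨i, fun x => hρ x.1 x.2⟩))
      (fun ρ ρ' h h' => Subgroup.mul_mem _ h h') σ hσ
  exact exists_galoisTwistAut_of_mem_closure Sc Ei hτ hMi hx₀ σ hmem K

end ComplexRecordSystem

end Literature.AlgebraicGeometry.ShimuraVarieties.UnitaryCanonicalModel

end
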